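import Literature.Analysis.InnerProduct.LensSpaceIsospectralRigidityTwicePrime
import Literature.Analysis.InnerProduct.LensSpaceIsospectralRigidityPrimePower
import HarnessLib

/-!
# Ikeda–Yamamoto's Main Theorem for `q = 2l^ν`: two isospectral three-dimensional lens spaces whose fundamental group has
# order twice an odd prime power are isometric (Ikeda–Yamamoto 1979, §8)

Layer `Literature/Analysis/InnerProduct`, namespace `Literature.Analysis.InnerProduct`; lane `lit-hodgefound`, prover seat
`lit-hodgefound-p06`, generation 45, row g45-#7. THEOREMS only (no definition, no instance, no notation, no named fact).
Companion of `LensSpaceIsospectralRigidityTwicePrime.lean` (row g45-#4: `q = 2l`, the halving `cot(πa/2l) = cot(π(a/2)/l)`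
and the §6 core for scaled points) and `LensSpaceIsospectralRigidityPrimePower.lean` (row g45-#6: `q = l^ν`, the relation
(7.5) and the combinatorics (7.6)–(7.28) of §7).

## Source, verbatim (held text `paper:doi-10-18910-4811`)

A. Ikeda, Y. Yamamoto, *On the spectra of 3-dimensional lens spaces*, Osaka J. Math. **16** (1979) 447–469, §8 (p. 463–464):
"**8. Proof of Main Theorem for `q = 2l^ν` (`l` is an odd prime and `ν ≥ 1`).** First, we consider the case (8.1)
`(p₁ + 1, q) = (p₁ − 1, q) = 2`. Since `k = 1` satisfies (4.13) and (4.14), by Corollary 4.7, we have (8.2)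
`cot(π/q₀)(p₁+1)/2 − cot(π/q₀)(p₁−1)/2 + cot(π/q₀)(p₁*+1)/2 − cot(π/q₀)(p₁*−1)/2 − [the same for p₂] = 0`, where
`q₀ = l^ν`. By (8.1), Lemma 4.2 and Lemma 4.4, all the integers `(pᵢ ± 1)/2`, `(pᵢ* ± 1)/2` are prime to `q₀`. Applying
Lemma 5.3 to (8.2), in the same way as in 6, we see either `p₁ ≡ ±p₂ (mod q₀)` or `p₁ ≡ ±p₂* (mod q₀)`. Since all the
integers `p₁, p₁*, p₂` and `p₂*` must be odd, we have either `p₁ ≡ ±p₂ (mod q)` or `p₁ ≡ ±p₂* (mod q)`, which proves our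
Main Theorem in this case. Next, we consider the case where one of the integers `(p₁ + 1)` and `(p₁ − 1)` is divisible by
`l`. Since `L(q : p₁)` (resp. `L(q : p₂)`) is isometric to `L(q : q − p₁)` (resp. `L(q : q − p₂)`), by Lemma 4.4, we may
assume (8.3) `(p₁ + 1, q) = (p₂ + 1, q) = 2l^μ` where `ν > μ ≥ 1`. Substituting by `k = 1` and `k = l^{ν−μ} − 1` (which
satisfy (4.13) and (4.14)) in (4.18), and taking their sum, we obtain (8.4)
`−cot(π/q₀)(p₁−1)/2 − cot(π/q₀)(p₁−1)k/2 − cot(π/q₀)(p₁*−1)/2 − cot(π/q₀)(p₁*−1)k/2 = [the same for p₂]`, where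
`k = l^{ν−μ} − 1`. By (8.3) and Lemma 4.2, all the integers `(pᵢ−1)/2`, `(pᵢ−1)k/2`, `(pᵢ*−1)/2`, `(pᵢ*−1)k/2` are
prime to `q₀`. Applying Lemma 5.3 to (8.4), in the same way as in 7, we see either `p₁ ≡ p₂ (mod q₀)` or
`p₁ ≡ p₂* (mod q₀)`. From this, as we have seen as before, we see either `p₁ ≡ p₂ (mod q)` or `p₁ ≡ p₂* (mod q)`, which
proves Main Theorem in this case (8.3). Thus we have proved Main Theorem for `q = 2l^ν`. q.e.d." — §6 (p. 459):
"**Lemma 6.1.** Main Theorem holds when `q ≤ 10`."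

## The proof, as formalised

`q = 2m` with `m` odd (`m = q₀`), `c = 2⁻¹ ∈ ℤ/m`; all weights are odd, so the arguments `pᵢ ± 1`, `K(pᵢ − 1)`, … of
(4.18) and (7.5) are even and `cot(πa/q) = cot(π·(c·a mod m)/m)` (row g45-#4's `cot_mul_div_two_mul`).
* §1 case (8.1) for ANY odd `m ≥ 3` with `(p₁ ± 1, m) = 1`: Corollary 4.5 in coprimality form for the modulus `2m`
  (`isCoprime_of_lensMultiplicity_eq_of_twice_odd`, from Lemma 4.4 in divisor form, row g45-#3), (4.18) at `k = 1` halved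
  to (8.2), Lemma 5.3 and the §6 core for the scaled points `c(P ± 1)` (row g45-#4's `eq_or_eq_neg_of_cot_relation_smul`),
  then the parity lift `m → 2m` (`dvd_of_lensMultiplicity_one_eq_of_twice_odd`).
* §2 case (8.3): (7.5) for the modulus `2m` (row g45-#6's `cot_pairSum_eq_of_lensMultiplicity_eq`, `K = m/l − 1`) halved
  to (8.4), Lemma 5.3 for the eight scaled units `c·a, c·Ka, …` of `ℤ/m`, un-scaling `y ↦ cy` of the signed-indicator
  identity, the combinatorics of §7 (row g45-#6's `eq_or_eq_of_signedIndicator_pair_eq`), parity lift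
  (`dvd_of_lensMultiplicity_one_eq_of_twice_dvd_add_one`; stated for `m` odd, `l` an odd prime with `l² ∣ m`,
  `l ∣ pᵢ + 1`, `(pᵢ − 1, m) = 1`).
* §3 THE MAIN THEOREM for `q = 2l^ν` (`dvd_of_lensMultiplicity_one_eq_of_twice_prime_pow`: `ν = 1` is row g45-#4;
  homogeneous weights by Corollary 3.4; (8.1) by §1; otherwise `l ∣ p₁ ± 1` and, after `pᵢ ↦ ±pᵢ` using Lemma 4.4, §2),
  general weights (`dvd_of_lensMultiplicity_eq_of_twice_prime_pow`), ISOSPECTRAL ⟺ ISOMETRIC for `q = 2l^ν`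
  (`lensMultiplicity_eq_iff_lensWeightsEquivalent_of_twice_prime_pow`) and for `q ∈ {l^ν, 2l^ν}` together
  (`lensMultiplicity_eq_iff_lensWeightsEquivalent_of_prime_pow_or_twice`: two of the three families of the Main Theorem).
* §4 small orders: `q ∣ 8` (every weight pair is homogeneous or `≡ (±1, ±3)`; Corollary 3.4) and LEMMA 6.1 as printed,
  "Main Theorem holds when `q ≤ 10`" (`lensMultiplicity_eq_iff_lensWeightsEquivalent_of_le_ten`).

## References

* [IkedaYamamoto1979] A. Ikeda, Y. Yamamoto, *On the spectra of 3-dimensional lens spaces*, Osaka J. Math. 16 (1979) 447–469: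
  Main Theorem (`q = 2l^ν`), §8 (8.1)–(8.4), §7, Lemma 4.4, Corollary 4.5, Corollary 4.7 (4.18), Lemma 5.3, Lemma 6.1,
  Corollary 3.4, Proposition 4.1, Proposition 1.1.
* [Okada1981] T. Okada, *On an extension of a theorem of S. Chowla*, Acta Arith. 38 (1980/81) 341–345 (Lemma 5.3 for all `q`).
* [Ikeda1980] A. Ikeda, *On lens spaces which are isospectral but not isometric*, Ann. Sci. ÉNS (4) 13 (1980) 303–315,
  Theorem 2.1 (the isometry criterion `LensWeightsEquivalent`).
-/

noncomputable section

open Finset Filter Topology Complex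

namespace Literature.Analysis.InnerProduct

open _root_.Real _root_.Filter _root_.Topology

/-! ### §0 Parity and residue bookkeeping for the modulus `q = 2m`, `m` odd -/

/-- `pp* ≡ 1 (mod n)` read in `ℤ/n`. [folklore] -/
private theorem cast_mul_cast_eq_one_tp {n : ℕ} {p u : ℤ} (hu : (n : ℤ) ∣ u * p - 1) :
    (u : ZMod n) * (p : ZMod n) = 1 := by
  have h := (ZMod.intCast_zmod_eq_zero_iff_dvd (u * p - 1) n).mpr hu
  push_cast at h
  exact sub_eq_zero.mp h

/-- A weight prime to `2m` is odd. [folklore] -/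
private theorem odd_of_isCoprime_two_mul_tp {m : ℕ} {p : ℤ} (hp : IsCoprime p ((2 * m : ℕ) : ℤ)) : Odd p := by
  rw [← Int.not_even_iff_odd]
  rintro ⟨c, rfl⟩
  obtain ⟨a, b, hab⟩ := hp
  push_cast at hab
  have : (2 : ℤ) ∣ 1 := ⟨a * c + b * m, by linear_combination -hab⟩
  omega

/-- For `m` odd and `s` even: `2m ∣ s ↔ m ∣ s`. [folklore] -/
private theorem two_mul_dvd_iff_tp {m : ℕ} (hm : Odd m) {s : ℤ} (hs : 2 ∣ s) : ((2 * m : ℕ) : ℤ) ∣ s ↔ (m : ℤ) ∣ s := by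
  have hcop : IsCoprime (2 : ℤ) (m : ℤ) := by
    rw [show (2 : ℤ) = ((2 : ℕ) : ℤ) by norm_num, Nat.isCoprime_iff_coprime]
    exact Nat.coprime_two_left.mpr hm
  push_cast
  exact ⟨fun h ↦ (dvd_mul_left (m : ℤ) 2).trans h, fun h ↦ hcop.mul_dvd hs h⟩

/-- A number prime to `m ≥ 2` is not divisible by `m`. [folklore] -/
private theorem not_dvd_of_isCoprime_tp {m : ℕ} (hm : 2 ≤ m) {t : ℤ} (ht : IsCoprime t m) : ¬ (m : ℤ) ∣ t := by
  rintro ⟨c, rfl⟩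
  obtain ⟨a, b, hab⟩ := ht
  have : (m : ℤ) ∣ 1 := ⟨a * c + b, by linear_combination -hab⟩
  have := Int.le_of_dvd one_pos this
  omega

/-- `p*` is odd and prime to `m` along with `p` (`pp* ≡ 1 (mod 2m)`). [folklore] -/
private theorem odd_inv_tp {m : ℕ} {p u : ℤ} (hu : ((2 * m : ℕ) : ℤ) ∣ u * p - 1) : Odd u := by
  have : Odd (u * p) := by
    obtain ⟨c, hc⟩ := hu
    exact ⟨c * m, by push_cast at hc; linear_combination hc⟩
  exact (Int.odd_mul.mp this).1

/-! ### §1 Case (8.1): `q = 2m`, `m` odd, `(p₁ ± 1, m) = 1` -/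

/-- **COROLLARY 4.5 in coprimality form for the modulus `2m`**: for isospectral `L(2m; 1, p₁)`, `L(2m; 1, p₂)` (`m` odd,
`pᵢpᵢ* ≡ 1`), if `p₁ + 1` and `p₁ − 1` are prime to `m` then so is `p₂ + s`, `s = ±1` (a common divisor `d > 1` of
`p₂ + s` and `m` is odd and divides `2m`, so by Lemma 4.4 (divisor form, row g45-#3) it divides `p₁ + 1` or `p₁ − 1`).
[cite: IkedaYamamoto1979, §8 ("by (8.1), Lemma 4.2 and Lemma 4.4"), Corollary 4.5, Lemma 4.4] -/
theorem isCoprime_of_lensMultiplicity_eq_of_twice_odd {m : ℕ} [NeZero m] (hmo : Odd m) {p₁ u₁ p₂ u₂ : ℤ}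
    (hu₁ : ((2 * m : ℕ) : ℤ) ∣ u₁ * p₁ - 1) (hu₂ : ((2 * m : ℕ) : ℤ) ∣ u₂ * p₂ - 1) (hc₁ : IsCoprime (p₁ + 1) m)
    (hc₂ : IsCoprime (p₁ - 1) m) (h : ∀ n : ℕ, lensMultiplicity (2 * m) 1 p₁ n = lensMultiplicity (2 * m) 1 p₂ n) {s : ℤ}
    (hs : s = 1 ∨ s = -1) : IsCoprime (p₂ + s) m := by
  haveI : NeZero (2 * m) := ⟨by have := NeZero.ne m; omega⟩
  rw [Int.isCoprime_iff_gcd_eq_one]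
  by_contra hne
  set d : ℕ := Int.gcd (p₂ + s) m with hd
  have hdp : (d : ℤ) ∣ p₂ + s := Int.gcd_dvd_left ..
  have hdm : (d : ℤ) ∣ (m : ℤ) := Int.gcd_dvd_right ..
  have hdm' : d ∣ m := by exact_mod_cast hdm
  have hdq : (d : ℤ) ∣ ((2 * m : ℕ) : ℤ) := hdm.trans (by push_cast; exact dvd_mul_left _ _)
  have hd0 : d ≠ 0 := fun h0 ↦ NeZero.ne m (Nat.eq_zero_of_zero_dvd (h0 ▸ hdm'))
  have hd2 : ¬ (d : ℤ) ∣ 2 := by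
    intro h2
    have h2' : d ∣ 2 := by exact_mod_cast h2
    have hdle : d ≤ 2 := Nat.le_of_dvd two_pos h2'
    have hdodd : ¬ 2 ∣ d := fun h2d ↦ (Nat.not_even_iff_odd.mpr hmo) (even_iff_two_dvd.mpr (h2d.trans hdm'))
    interval_cases d <;> simp_all
  have key := dvd_or_dvd_of_dvd_of_lensMultiplicity_eq hu₂ hu₁ (fun n ↦ (h n).symm) hdq hd2
    (by rcases hs with rfl | rfl
        · exact Or.inl hdp
        · exact Or.inr (by rw [sub_eq_add_neg]; exact hdp))
  have hd1 : (d : ℤ) ∣ 1 := by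
    rcases key with hk | hk
    · obtain ⟨a, b, hab⟩ := hc₁
      obtain ⟨c, hc⟩ := hk
      obtain ⟨e, he⟩ := hdm
      exact ⟨a * c + b * e, by rw [← hab, hc, he]; ring⟩
    · obtain ⟨a, b, hab⟩ := hc₂
      obtain ⟨c, hc⟩ := hk
      obtain ⟨e, he⟩ := hdm
      exact ⟨a * c + b * e, by rw [← hab, hc, he]; ring⟩
  have := Int.eq_one_of_dvd_one (by positivity) hd1
  exact hne (by exact_mod_cast this)

/-- **§8, case (8.1) — THE MAIN THEOREM for `q = 2m`, `m ≥ 3` odd, normalized weights, under `(p₁ ± 1, m) = 1`.** If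
`L(2m; 1, p₁)` and `L(2m; 1, p₂)` (`pᵢ` prime to `2m`) are isospectral and `p₁ + 1`, `p₁ − 1` are prime to `m` — for
`m = l^ν` this is (8.1) `(p₁ ± 1, q) = 2` — then `p₁ ≡ ±p₂` or `p₁p₂ ≡ ±1 (mod 2m)`: (4.18) at `k = 1` for the modulus `2m`,
halved to (8.2) for the modulus `m` (`cot(π(p±1)/2m) = cot(π·((p±1)/2)~/m)`), Lemma 5.3 "in the same way as in 6" (the core of
row g45-#4 for the points `c(P ± 1)`, `c = 2⁻¹`), and the lift `m → 2m` by parity ("all the integers `p₁, p₁*, p₂, p₂*`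
must be odd"). [cite: IkedaYamamoto1979, Main Theorem (`q = 2l^ν`), §8 (8.1)–(8.2), Proposition 4.1] -/
theorem dvd_of_lensMultiplicity_one_eq_of_twice_odd {m : ℕ} [NeZero m] (hmo : Odd m) (hm3 : 3 ≤ m) {p₁ p₂ : ℤ}
    (hp₁ : IsCoprime p₁ ((2 * m : ℕ) : ℤ)) (hp₂ : IsCoprime p₂ ((2 * m : ℕ) : ℤ)) (hc₁ : IsCoprime (p₁ + 1) m)
    (hc₂ : IsCoprime (p₁ - 1) m) (h : ∀ n : ℕ, lensMultiplicity (2 * m) 1 p₁ n = lensMultiplicity (2 * m) 1 p₂ n) :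
    ((2 * m : ℕ) : ℤ) ∣ p₁ - p₂ ∨ ((2 * m : ℕ) : ℤ) ∣ p₁ + p₂ ∨
      ((2 * m : ℕ) : ℤ) ∣ p₁ * p₂ - 1 ∨ ((2 * m : ℕ) : ℤ) ∣ p₁ * p₂ + 1 := by
  haveI : NeZero (2 * m) := ⟨by omega⟩
  haveI : Nontrivial (ZMod m) := ZMod.nontrivial_iff.mpr (by omega)
  have hodd₁ := odd_of_isCoprime_two_mul_tp hp₁
  have hodd₂ := odd_of_isCoprime_two_mul_tp hp₂
  obtain ⟨u₁, b₁, hub₁⟩ := hp₁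
  obtain ⟨u₂, b₂, hub₂⟩ := hp₂
  have hu₁ : ((2 * m : ℕ) : ℤ) ∣ u₁ * p₁ - 1 := ⟨-b₁, by linear_combination hub₁⟩
  have hu₂ : ((2 * m : ℕ) : ℤ) ∣ u₂ * p₂ - 1 := ⟨-b₂, by linear_combination hub₂⟩
  have hoddu₁ := odd_inv_tp hu₁
  have hoddu₂ := odd_inv_tp hu₂
  -- Corollary 4.5: `p₂ ± 1` are prime to `m`
  have hd₁ := isCoprime_of_lensMultiplicity_eq_of_twice_odd hmo hu₁ hu₂ hc₁ hc₂ h (s := 1) (Or.inl rfl)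
  have hd₂ := isCoprime_of_lensMultiplicity_eq_of_twice_odd hmo hu₁ hu₂ hc₁ hc₂ h (s := -1) (Or.inr rfl)
  rw [← sub_eq_add_neg] at hd₂
  -- (4.18) at `k = 1` for the modulus `2m`
  have ev : ∀ {t : ℤ}, Odd t → (2 : ℤ) ∣ 1 * (t + 1) ∧ (2 : ℤ) ∣ 1 * (t - 1) := fun ht ↦ by
    obtain ⟨r, rfl⟩ := ht
    exact ⟨⟨r + 1, by ring⟩, ⟨r, by ring⟩⟩
  have nd : ∀ {t : ℤ}, (2 : ℤ) ∣ t → IsCoprime t m → ¬ ((2 * m : ℕ) : ℤ) ∣ t := fun h2t ht hdvd ↦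
    not_dvd_of_isCoprime_tp (by omega) ht ((two_mul_dvd_iff_tp hmo h2t).mp hdvd)
  have h2 : ¬ ((2 * m : ℕ) : ℤ) ∣ 2 * 1 := by
    intro hdvd
    have := Int.le_of_dvd (by norm_num) hdvd
    push_cast at this
    have : (3 : ℤ) ≤ m := by exact_mod_cast hm3
    omega
  have hrel := cot_alternatingSum_eq_of_lensMultiplicity_eq' (q := 2 * m) (k := 1) hu₁ hu₂ h2
    (nd (ev hodd₁).2 (by rw [one_mul]; exact hc₂)) (nd (ev hodd₁).1 (by rw [one_mul]; exact hc₁)) h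
  -- halving: to the modulus `m` and the points `c(P ± 1)`, …
  have h2u : IsUnit (2 : ZMod m) := by
    have := (ZMod.isUnit_iff_coprime 2 m).mpr (Nat.coprime_two_left.mpr hmo)
    exact_mod_cast this
  obtain ⟨c, hc2⟩ := h2u.exists_left_inv
  have hcu : IsUnit c := IsUnit.of_mul_eq_one _ hc2
  rw [cot_mul_div_two_mul hc2 (ev hodd₁).1, cot_mul_div_two_mul hc2 (ev hodd₁).2, cot_mul_div_two_mul hc2 (ev hoddu₁).1,
    cot_mul_div_two_mul hc2 (ev hoddu₁).2, cot_mul_div_two_mul hc2 (ev hodd₂).1, cot_mul_div_two_mul hc2 (ev hodd₂).2,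
    cot_mul_div_two_mul hc2 (ev hoddu₂).1, cot_mul_div_two_mul hc2 (ev hoddu₂).2] at hrel
  have c1 : c * ((1 * (p₁ + 1) : ℤ) : ZMod m) = c * ((p₁ : ZMod m) + 1) := by push_cast; ring
  have c2 : c * ((1 * (p₁ - 1) : ℤ) : ZMod m) = c * ((p₁ : ZMod m) - 1) := by push_cast; ring
  have c3 : c * ((1 * (u₁ + 1) : ℤ) : ZMod m) = c * ((u₁ : ZMod m) + 1) := by push_cast; ring
  have c4 : c * ((1 * (u₁ - 1) : ℤ) : ZMod m) = c * ((u₁ : ZMod m) - 1) := by push_cast; ring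
  have c5 : c * ((1 * (p₂ + 1) : ℤ) : ZMod m) = c * ((p₂ : ZMod m) + 1) := by push_cast; ring
  have c6 : c * ((1 * (p₂ - 1) : ℤ) : ZMod m) = c * ((p₂ : ZMod m) - 1) := by push_cast; ring
  have c7 : c * ((1 * (u₂ + 1) : ℤ) : ZMod m) = c * ((u₂ : ZMod m) + 1) := by push_cast; ring
  have c8 : c * ((1 * (u₂ - 1) : ℤ) : ZMod m) = c * ((u₂ : ZMod m) - 1) := by push_cast; ring
  rw [c1, c2, c3, c4, c5, c6, c7, c8] at hrel
  -- the hypotheses of the combinatorial core, in `ℤ/m`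
  have hm2m : (m : ℤ) ∣ ((2 * m : ℕ) : ℤ) := Dvd.intro_left 2 (by push_cast; ring)
  have hUP := cast_mul_cast_eq_one_tp (hm2m.trans hu₁)
  have hVQ := cast_mul_cast_eq_one_tp (hm2m.trans hu₂)
  have unit_of : ∀ {t : ℤ}, IsCoprime t m → IsUnit (t : ZMod m) := fun ht ↦
    (ZMod.coe_int_isUnit_iff_isCoprime _ _).mpr ht.symm
  have hP1 : IsUnit ((p₁ : ZMod m) + 1) := by have := unit_of hc₁; push_cast at this; exact this
  have hP2 : IsUnit ((p₁ : ZMod m) - 1) := by have := unit_of hc₂; push_cast at this; exact this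
  have hQ1 : IsUnit ((p₂ : ZMod m) + 1) := by have := unit_of hd₁; push_cast at this; exact this
  have hQ2 : IsUnit ((p₂ : ZMod m) - 1) := by have := unit_of hd₂; push_cast at this; exact this
  have hU : IsUnit (u₁ : ZMod m) := IsUnit.of_mul_eq_one _ hUP
  have hV : IsUnit (u₂ : ZMod m) := IsUnit.of_mul_eq_one _ hVQ
  have hU1 : IsUnit ((u₁ : ZMod m) + 1) := by
    rw [show (u₁ : ZMod m) + 1 = (u₁ : ZMod m) * ((p₁ : ZMod m) + 1) by linear_combination -hUP]
    exact hU.mul hP1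
  have hU2 : IsUnit ((u₁ : ZMod m) - 1) := by
    rw [show (u₁ : ZMod m) - 1 = -((u₁ : ZMod m) * ((p₁ : ZMod m) - 1)) by linear_combination hUP]
    exact (hU.mul hP2).neg
  have hV1 : IsUnit ((u₂ : ZMod m) + 1) := by
    rw [show (u₂ : ZMod m) + 1 = (u₂ : ZMod m) * ((p₂ : ZMod m) + 1) by linear_combination -hVQ]
    exact hV.mul hQ1
  have hV2 : IsUnit ((u₂ : ZMod m) - 1) := by
    rw [show (u₂ : ZMod m) - 1 = -((u₂ : ZMod m) * ((p₂ : ZMod m) - 1)) by linear_combination hVQ]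
    exact (hV.mul hQ2).neg
  have hP0 : (p₁ : ZMod m) ≠ 0 := fun h0 ↦ by rw [h0, mul_zero] at hUP; exact zero_ne_one hUP
  have hU0 : (u₁ : ZMod m) ≠ 0 := fun h0 ↦ by rw [h0, zero_mul] at hUP; exact zero_ne_one hUP
  have hQ0 : (p₂ : ZMod m) ≠ 0 := fun h0 ↦ by rw [h0, mul_zero] at hVQ; exact zero_ne_one hVQ
  have hV0 : (u₂ : ZMod m) ≠ 0 := fun h0 ↦ by rw [h0, zero_mul] at hVQ; exact zero_ne_one hVQ
  have key := eq_or_eq_neg_of_cot_relation_smul (by omega) h2u hcu hP0 hU0 hQ0 hV0 (hcu.mul hP1) (hcu.mul hP2)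
    (hcu.mul hU1) (hcu.mul hU2) (hcu.mul hQ1) (hcu.mul hQ2) (hcu.mul hV1) (hcu.mul hV2) hrel
  -- back to congruences mod `m`, then mod `2m` by parity
  have par : ∀ {s : ℤ}, Even s → (m : ℤ) ∣ s → ((2 * m : ℕ) : ℤ) ∣ s := fun hs hd ↦
    (two_mul_dvd_iff_tp hmo (even_iff_two_dvd.mp hs)).mpr hd
  rcases key with e | e | e | e
  · refine Or.inl (par (hodd₁.sub_odd hodd₂) ((ZMod.intCast_zmod_eq_zero_iff_dvd _ _).mp ?_))
    push_cast; rw [e]; ring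
  · refine Or.inr (Or.inl (par (hodd₁.add_odd hodd₂) ((ZMod.intCast_zmod_eq_zero_iff_dvd _ _).mp ?_)))
    push_cast; rw [e]; ring
  · refine Or.inr (Or.inr (Or.inl (par ((hodd₁.mul hodd₂).sub_odd odd_one)
      ((ZMod.intCast_zmod_eq_zero_iff_dvd _ _).mp ?_))))
    push_cast; rw [e]; linear_combination hUP
  · refine Or.inr (Or.inr (Or.inr (par ((hodd₁.mul hodd₂).add_odd odd_one)
      ((ZMod.intCast_zmod_eq_zero_iff_dvd _ _).mp ?_))))
    push_cast; rw [e]; linear_combination -hUP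

/-! ### §2 Case (8.3): `q = 2m`, `l² ∣ m`, `l ∣ pᵢ + 1` -/

/-- **§8, case (8.3) — THE MAIN THEOREM for `q = 2m`, normalized weights, when `l ∣ pᵢ + 1`.** Let `m` be odd and `l` an
odd prime with `l² ∣ m`; let `p₁, p₂` be prime to `2m` with `p₁ − 1`, `p₂ − 1` prime to `m`, `l ∣ p₁ + 1`, `l ∣ p₂ + 1`
and `2m ∤ p₁ + 1` (for `m = l^ν`: the normalization (8.3) `(p₁ + 1, q) = (p₂ + 1, q) = 2l^μ`, `1 ≤ μ < ν`). If
`L(2m; 1, p₁)` and `L(2m; 1, p₂)` are isospectral then `p₁ ≡ p₂` or `p₁p₂ ≡ 1 (mod 2m)`: (7.5) for the modulus `2m` with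
`K = m/l − 1` (row g45-#6), halved to (8.4), Lemma 5.3 for the eight scaled units `c(pᵢ − 1)~`, `cK(pᵢ − 1)~`, … of
`ℤ/m` (`c = 2⁻¹`), the combinatorics of §7 "in the same way as in 7" (row g45-#6's `eq_or_eq_of_signedIndicator_pair_eq`,
after un-scaling `y ↦ cy`), and the parity lift. [cite: IkedaYamamoto1979, Main Theorem (`q = 2l^ν`), §8 (8.3)–(8.4), §7] -/
theorem dvd_of_lensMultiplicity_one_eq_of_twice_dvd_add_one {m l : ℕ} [NeZero m] (hmo : Odd m) (hl : l.Prime)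
    (hl2 : l ≠ 2) (hll : l * l ∣ m) {p₁ p₂ : ℤ} (hp₁ : IsCoprime p₁ ((2 * m : ℕ) : ℤ)) (hp₂ : IsCoprime p₂ ((2 * m : ℕ) : ℤ))
    (hm₁ : IsCoprime (p₁ - 1) m) (hm₂ : IsCoprime (p₂ - 1) m) (hl₁ : (l : ℤ) ∣ p₁ + 1) (hl₂ : (l : ℤ) ∣ p₂ + 1)
    (hq₁ : ¬ ((2 * m : ℕ) : ℤ) ∣ p₁ + 1) (h : ∀ n : ℕ, lensMultiplicity (2 * m) 1 p₁ n = lensMultiplicity (2 * m) 1 p₂ n) :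
    ((2 * m : ℕ) : ℤ) ∣ p₁ - p₂ ∨ ((2 * m : ℕ) : ℤ) ∣ p₁ * p₂ - 1 := by
  -- `m = m'l`, `l ∣ m'`, `K = m' − 1`
  have hlm : l ∣ m := (dvd_mul_right l l).trans hll
  set m' : ℕ := m / l with hm'
  have hmm : m = m' * l := (Nat.div_mul_cancel hlm).symm
  have hlm' : l ∣ m' := (Nat.dvd_div_iff_mul_dvd hlm).mpr hll
  have hl3 : 3 ≤ l := by have := hl.two_le; omega
  have hm0 : 0 < m := Nat.pos_of_ne_zero (NeZero.ne m)
  have hm'm : m' < m := Nat.div_lt_self hm0 (by omega)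
  have hm'0 : m' ≠ 0 := by
    intro h0
    rw [h0, zero_mul] at hmm
    exact NeZero.ne m hmm
  have hm3 : 2 < m := by
    have : l * l ≤ m := Nat.le_of_dvd hm0 hll
    nlinarith
  haveI : NeZero (2 * m) := ⟨by omega⟩
  haveI : Nontrivial (ZMod m) := ZMod.nontrivial_iff.mpr (by omega)
  set K : ℤ := (m' : ℤ) - 1 with hK
  -- parity and inverses
  have hodd₁ := odd_of_isCoprime_two_mul_tp hp₁
  have hodd₂ := odd_of_isCoprime_two_mul_tp hp₂
  obtain ⟨u₁, b₁, hub₁⟩ := hp₁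
  obtain ⟨u₂, b₂, hub₂⟩ := hp₂
  have hu₁ : ((2 * m : ℕ) : ℤ) ∣ u₁ * p₁ - 1 := ⟨-b₁, by linear_combination hub₁⟩
  have hu₂ : ((2 * m : ℕ) : ℤ) ∣ u₂ * p₂ - 1 := ⟨-b₂, by linear_combination hub₂⟩
  have hoddu₁ := odd_inv_tp hu₁
  have hoddu₂ := odd_inv_tp hu₂
  have hm2m : (m : ℤ) ∣ ((2 * m : ℕ) : ℤ) := Dvd.intro_left 2 (by push_cast; ring)
  -- `K` is prime to `m` (`l ∣ m'`), hence to `2m`-divisibility questions below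
  have hmmz : (m : ℤ) = (m' : ℤ) * (l : ℤ) := by exact_mod_cast hmm
  have hKc : IsCoprime K m := by
    have hKm : IsCoprime K (m' : ℤ) := ⟨-1, 1, by rw [hK]; ring⟩
    have hKl : IsCoprime K (l : ℤ) := by
      obtain ⟨t, ht⟩ := hlm'
      exact ⟨-1, (t : ℤ), by rw [hK, ht]; push_cast; ring⟩
    rw [hmmz]
    exact hKm.mul_right hKl
  -- the hypotheses of (7.5) for the modulus `2m`
  have nd : ∀ {t : ℤ}, (2 : ℤ) ∣ t → IsCoprime t m → ¬ ((2 * m : ℕ) : ℤ) ∣ t := fun h2t ht hdvd ↦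
    not_dvd_of_isCoprime_tp (by omega) ht ((two_mul_dvd_iff_tp hmo h2t).mp hdvd)
  have ev2 : ∀ {t : ℤ}, Odd t → (2 : ℤ) ∣ t - 1 := fun ⟨r, hr⟩ ↦ ⟨r, by rw [hr]; ring⟩
  have ev2' : ∀ {t : ℤ}, Odd t → (2 : ℤ) ∣ t + 1 := fun ⟨r, hr⟩ ↦ ⟨r + 1, by rw [hr]; ring⟩
  have h2 : ¬ ((2 * m : ℕ) : ℤ) ∣ 2 := by
    intro hdvd
    have := Int.le_of_dvd two_pos hdvd
    push_cast at this
    omega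
  have h2K : ¬ ((2 * m : ℕ) : ℤ) ∣ 2 * K := by
    intro hdvd
    push_cast at hdvd
    have : (m : ℤ) ∣ K := (mul_dvd_mul_iff_left two_ne_zero).mp hdvd
    exact not_dvd_of_isCoprime_tp (by omega) hKc this
  have hm₁' : ¬ ((2 * m : ℕ) : ℤ) ∣ p₁ - 1 := nd (ev2 hodd₁) hm₁
  have hmK : ¬ ((2 * m : ℕ) : ℤ) ∣ K * (p₁ - 1) := nd ((ev2 hodd₁).mul_left K) (hKc.mul_left hm₁)
  have hpK : ¬ ((2 * m : ℕ) : ℤ) ∣ K * (p₁ + 1) := by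
    intro hdvd
    apply hq₁
    have h1 : (m : ℤ) ∣ K * (p₁ + 1) := hm2m.trans hdvd
    have h2' : (m : ℤ) ∣ p₁ + 1 := hKc.symm.dvd_of_dvd_mul_left h1
    exact (two_mul_dvd_iff_tp hmo (ev2' hodd₁)).mpr h2'
  have hK1dvd : ∀ {p : ℤ}, Odd p → (l : ℤ) ∣ p + 1 → ((2 * m : ℕ) : ℤ) ∣ (K + 1) * (p + 1) := by
    intro p hp hlp
    have hcop : IsCoprime (2 : ℤ) (l : ℤ) := by
      rw [show (2 : ℤ) = ((2 : ℕ) : ℤ) by norm_num, Nat.isCoprime_iff_coprime]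
      exact Nat.coprime_two_left.mpr (hl.odd_of_ne_two hl2)
    have h2l : (2 : ℤ) * l ∣ p + 1 := hcop.mul_dvd (ev2' hp) hlp
    rw [hK, sub_add_cancel, show ((2 * m : ℕ) : ℤ) = (m' : ℤ) * (2 * l) by push_cast; rw [hmmz]; ring]
    exact mul_dvd_mul_left _ h2l
  -- (7.5) for the modulus `2m`
  have hrel := cot_pairSum_eq_of_lensMultiplicity_eq (q := 2 * m) hu₁ hu₂ h2 h2K hm₁' hq₁ hmK hpK (hK1dvd hodd₁ hl₁)
    (hK1dvd hodd₂ hl₂) h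
  -- halving: to the modulus `m`
  have h2u : IsUnit (2 : ZMod m) := by
    have := (ZMod.isUnit_iff_coprime 2 m).mpr (Nat.coprime_two_left.mpr hmo)
    exact_mod_cast this
  obtain ⟨c, hc2⟩ := h2u.exists_left_inv
  have hcu : IsUnit c := IsUnit.of_mul_eq_one _ hc2
  rw [cot_mul_div_two_mul hc2 (ev2 hodd₁), cot_mul_div_two_mul hc2 ((ev2 hodd₁).mul_left K),
    cot_mul_div_two_mul hc2 (ev2 hoddu₁), cot_mul_div_two_mul hc2 ((ev2 hoddu₁).mul_left K),
    cot_mul_div_two_mul hc2 (ev2 hodd₂), cot_mul_div_two_mul hc2 ((ev2 hodd₂).mul_left K),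
    cot_mul_div_two_mul hc2 (ev2 hoddu₂), cot_mul_div_two_mul hc2 ((ev2 hoddu₂).mul_left K)] at hrel
  have c1 : c * ((p₁ - 1 : ℤ) : ZMod m) = c * ((p₁ : ZMod m) - 1) := by push_cast; ring
  have c2 : c * ((K * (p₁ - 1) : ℤ) : ZMod m) = c * ((K : ZMod m) * ((p₁ : ZMod m) - 1)) := by push_cast; ring
  have c3 : c * ((u₁ - 1 : ℤ) : ZMod m) = c * ((u₁ : ZMod m) - 1) := by push_cast; ring
  have c4 : c * ((K * (u₁ - 1) : ℤ) : ZMod m) = c * ((K : ZMod m) * ((u₁ : ZMod m) - 1)) := by push_cast; ring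
  have c5 : c * ((p₂ - 1 : ℤ) : ZMod m) = c * ((p₂ : ZMod m) - 1) := by push_cast; ring
  have c6 : c * ((K * (p₂ - 1) : ℤ) : ZMod m) = c * ((K : ZMod m) * ((p₂ : ZMod m) - 1)) := by push_cast; ring
  have c7 : c * ((u₂ - 1 : ℤ) : ZMod m) = c * ((u₂ : ZMod m) - 1) := by push_cast; ring
  have c8 : c * ((K * (u₂ - 1) : ℤ) : ZMod m) = c * ((K : ZMod m) * ((u₂ : ZMod m) - 1)) := by push_cast; ring
  rw [c1, c2, c3, c4, c5, c6, c7, c8] at hrel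
  -- units of `ℤ/m`
  have hUP := cast_mul_cast_eq_one_tp (hm2m.trans hu₁)
  have hVQ := cast_mul_cast_eq_one_tp (hm2m.trans hu₂)
  have unit_of : ∀ {t : ℤ}, IsCoprime t m → IsUnit (t : ZMod m) := fun ht ↦
    (ZMod.coe_int_isUnit_iff_isCoprime _ _).mpr ht.symm
  have ha : IsUnit ((p₁ : ZMod m) - 1) := by have := unit_of hm₁; push_cast at this; exact this
  have hc : IsUnit ((p₂ : ZMod m) - 1) := by have := unit_of hm₂; push_cast at this; exact this
  have hKu : IsUnit (K : ZMod m) := unit_of hKc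
  have hU : IsUnit (u₁ : ZMod m) := IsUnit.of_mul_eq_one _ hUP
  have hV : IsUnit (u₂ : ZMod m) := IsUnit.of_mul_eq_one _ hVQ
  have hb : IsUnit ((u₁ : ZMod m) - 1) := by
    rw [show (u₁ : ZMod m) - 1 = -((u₁ : ZMod m) * ((p₁ : ZMod m) - 1)) by linear_combination hUP]
    exact (hU.mul ha).neg
  have hd : IsUnit ((u₂ : ZMod m) - 1) := by
    rw [show (u₂ : ZMod m) - 1 = -((u₂ : ZMod m) * ((p₂ : ZMod m) - 1)) by linear_combination hVQ]
    exact (hV.mul hc).neg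
  have s1 := hcu.mul ha
  have s2 := hcu.mul (hKu.mul ha)
  have s3 := hcu.mul hb
  have s4 := hcu.mul (hKu.mul hb)
  have s5 := hcu.mul hc
  have s6 := hcu.mul (hKu.mul hc)
  have s7 := hcu.mul hd
  have s8 := hcu.mul (hKu.mul hd)
  -- Lemma 5.3 for the eight scaled units of (8.4)
  have hind0 := sum_signedIndicator_eq_zero_of_sum_mul_cot_eq_zero hm3
    ![c * ((p₁ : ZMod m) - 1), c * ((K : ZMod m) * ((p₁ : ZMod m) - 1)), c * ((u₁ : ZMod m) - 1),
      c * ((K : ZMod m) * ((u₁ : ZMod m) - 1)), c * ((p₂ : ZMod m) - 1), c * ((K : ZMod m) * ((p₂ : ZMod m) - 1)),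
      c * ((u₂ : ZMod m) - 1), c * ((K : ZMod m) * ((u₂ : ZMod m) - 1))]
    (by intro i; fin_cases i <;> assumption) ![1, 1, 1, 1, -1, -1, -1, -1]
    (by simp only [Fin.sum_univ_eight, Matrix.cons_val]; push_cast; linear_combination hrel)
  -- un-scaling `y ↦ cy`: the signed-indicator identity for the points `P − 1`, `K(P − 1)`, …
  have hind : ∀ y : ZMod m,
        ((if y = ((p₁ : ZMod m) - 1) then (1 : ℤ) else 0) - (if y = -(((p₁ : ZMod m) - 1)) then 1 else 0)) +
          ((if y = ((K : ZMod m) * ((p₁ : ZMod m) - 1)) then (1 : ℤ) else 0) - (if y = -(((K : ZMod m) * ((p₁ : ZMod m) - 1))) then 1 else 0)) +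
          ((if y = ((u₁ : ZMod m) - 1) then (1 : ℤ) else 0) - (if y = -(((u₁ : ZMod m) - 1)) then 1 else 0)) +
          ((if y = ((K : ZMod m) * ((u₁ : ZMod m) - 1)) then (1 : ℤ) else 0) - (if y = -(((K : ZMod m) * ((u₁ : ZMod m) - 1))) then 1 else 0)) =
        ((if y = ((p₂ : ZMod m) - 1) then (1 : ℤ) else 0) - (if y = -(((p₂ : ZMod m) - 1)) then 1 else 0)) +
          ((if y = ((K : ZMod m) * ((p₂ : ZMod m) - 1)) then (1 : ℤ) else 0) - (if y = -(((K : ZMod m) * ((p₂ : ZMod m) - 1))) then 1 else 0)) +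
          ((if y = ((u₂ : ZMod m) - 1) then (1 : ℤ) else 0) - (if y = -(((u₂ : ZMod m) - 1)) then 1 else 0)) +
          ((if y = ((K : ZMod m) * ((u₂ : ZMod m) - 1)) then (1 : ℤ) else 0) - (if y = -(((K : ZMod m) * ((u₂ : ZMod m) - 1))) then 1 else 0)) := by
    intro y
    have h0 := hind0 (c * y)
    rw [Fin.sum_univ_eight] at h0
    have h1 : (1 : ℤ) * ((if c * y = c * ((p₁ : ZMod m) - 1) then (1 : ℤ) else 0) - (if c * y = -(c * ((p₁ : ZMod m) - 1)) then 1 else 0)) +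
      (1 : ℤ) * ((if c * y = c * ((K : ZMod m) * ((p₁ : ZMod m) - 1)) then (1 : ℤ) else 0) -
        (if c * y = -(c * ((K : ZMod m) * ((p₁ : ZMod m) - 1))) then 1 else 0)) +
      1 * ((if c * y = c * ((u₁ : ZMod m) - 1) then (1 : ℤ) else 0) - (if c * y = -(c * ((u₁ : ZMod m) - 1)) then 1 else 0)) +
      1 * ((if c * y = c * ((K : ZMod m) * ((u₁ : ZMod m) - 1)) then (1 : ℤ) else 0) -
        (if c * y = -(c * ((K : ZMod m) * ((u₁ : ZMod m) - 1))) then 1 else 0)) +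
      (-1) * ((if c * y = c * ((p₂ : ZMod m) - 1) then (1 : ℤ) else 0) - (if c * y = -(c * ((p₂ : ZMod m) - 1)) then 1 else 0)) +
      (-1) * ((if c * y = c * ((K : ZMod m) * ((p₂ : ZMod m) - 1)) then (1 : ℤ) else 0) -
        (if c * y = -(c * ((K : ZMod m) * ((p₂ : ZMod m) - 1))) then 1 else 0)) +
      (-1) * ((if c * y = c * ((u₂ : ZMod m) - 1) then (1 : ℤ) else 0) - (if c * y = -(c * ((u₂ : ZMod m) - 1)) then 1 else 0)) +
      (-1) * ((if c * y = c * ((K : ZMod m) * ((u₂ : ZMod m) - 1)) then (1 : ℤ) else 0) -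
        (if c * y = -(c * ((K : ZMod m) * ((u₂ : ZMod m) - 1))) then 1 else 0)) = 0 := h0
    have hneg : ∀ s : ZMod m, (c * y = -(c * s) ↔ y = -s) := fun s ↦ by rw [← mul_neg, hcu.mul_right_inj]
    simp only [hcu.mul_right_inj, hneg] at h1
    linear_combination h1
  -- the hypotheses of the §7 core in `ℤ/m`
  have hP : (p₁ : ZMod m) + 1 ≠ 0 := by
    intro h0
    apply hq₁
    have : (m : ℤ) ∣ p₁ + 1 := (ZMod.intCast_zmod_eq_zero_iff_dvd _ _).mp (by push_cast; exact h0)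
    exact (two_mul_dvd_iff_tp hmo (ev2' hodd₁)).mpr this
  have hq₂ : ¬ ((2 * m : ℕ) : ℤ) ∣ p₂ + 1 := by
    have := (not_dvd_of_lensMultiplicity_eq (k := 1) hu₁ hu₂ (by rwa [mul_one]) (by rwa [one_mul])
      (by rwa [one_mul]) h).1
    rwa [one_mul] at this
  have hQ : (p₂ : ZMod m) + 1 ≠ 0 := by
    intro h0
    apply hq₂
    have : (m : ℤ) ∣ p₂ + 1 := (ZMod.intCast_zmod_eq_zero_iff_dvd _ _).mp (by push_cast; exact h0)
    exact (two_mul_dvd_iff_tp hmo (ev2' hodd₂)).mpr this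
  have hK1 : (K : ZMod m) + 1 ≠ 0 := by
    intro h0
    have hdv : (m : ℤ) ∣ (m' : ℤ) := (ZMod.intCast_zmod_eq_zero_iff_dvd _ _).mp (by
      rw [hK] at h0; push_cast at h0 ⊢; linear_combination h0)
    have := Int.le_of_dvd (by exact_mod_cast Nat.pos_of_ne_zero hm'0) hdv
    have : (m' : ℤ) < m := by exact_mod_cast hm'm
    omega
  have hK2 : ((K : ZMod m) + 1) * ((K : ZMod m) - 1) ≠ 0 := by
    intro h0
    have hdv : (m : ℤ) ∣ (m' : ℤ) * ((m' : ℤ) - 2) := (ZMod.intCast_zmod_eq_zero_iff_dvd _ _).mp (by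
      rw [hK] at h0; push_cast at h0 ⊢; linear_combination h0)
    rw [hmmz] at hdv
    have hm0' : (m' : ℤ) ≠ 0 := by exact_mod_cast hm'0
    have hd' : (l : ℤ) ∣ (m' : ℤ) - 2 := (mul_dvd_mul_iff_left hm0').mp hdv
    have hlm'' : (l : ℤ) ∣ (m' : ℤ) := by exact_mod_cast hlm'
    have hl2' : (l : ℤ) ∣ 2 := by
      have := dvd_sub hlm'' hd'; rwa [show (m' : ℤ) - ((m' : ℤ) - 2) = 2 by ring] at this
    have : l ∣ 2 := by exact_mod_cast hl2'
    exact hl2 ((Nat.le_of_dvd two_pos this).antisymm hl.two_le)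
  have key := eq_or_eq_of_signedIndicator_pair_eq hm3 h2u hUP hVQ ha hc hP hQ hKu hK1 hK2 hind
  -- back to congruences mod `m`, then mod `2m` by parity
  have par : ∀ {s : ℤ}, Even s → (m : ℤ) ∣ s → ((2 * m : ℕ) : ℤ) ∣ s := fun hs hd ↦
    (two_mul_dvd_iff_tp hmo (even_iff_two_dvd.mp hs)).mpr hd
  rcases key with e | e
  · refine Or.inl (par (hodd₁.sub_odd hodd₂) ((ZMod.intCast_zmod_eq_zero_iff_dvd _ _).mp ?_))
    push_cast; rw [e]; ring
  · refine Or.inr (par ((hodd₁.mul hodd₂).sub_odd odd_one) ((ZMod.intCast_zmod_eq_zero_iff_dvd _ _).mp ?_))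
    push_cast; rw [e]; linear_combination hUP

/-! ### §3 THE MAIN THEOREM for `q = 2l^ν` -/

/-- An odd prime `l` divides at most one of `t + 1`, `t − 1`. [folklore] -/
private theorem not_dvd_sub_one_of_dvd_add_one_tp {l : ℕ} (hl : l.Prime) (hl2 : l ≠ 2) {t : ℤ} (h : (l : ℤ) ∣ t + 1) :
    ¬ (l : ℤ) ∣ t - 1 := by
  intro h'
  have h2 : (l : ℤ) ∣ 2 := by have := dvd_sub h h'; rwa [show t + 1 - (t - 1) = 2 by ring] at this
  have h2' : l ∣ 2 := by exact_mod_cast h2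
  exact hl2 ((Nat.le_of_dvd two_pos h2').antisymm hl.two_le)

/-- **THE MAIN THEOREM (Ikeda–Yamamoto 1979) for `q = 2l^ν`, `l` an odd prime, `ν ≥ 1`, normalized weights.** Let `p₁, p₂`
be prime to `q = 2l^ν`. If `L(q; 1, p₁)` and `L(q; 1, p₂)` are isospectral (`dim E_{n(n+2)}` agree for all `n`) then
`p₁ ≡ ±p₂` or `p₁p₂ ≡ ±1 (mod q)` — (4.1)/(4.2) of Proposition 4.1: the two lens spaces are isometric. Cases: `ν = 1` is
row g45-#4; the homogeneous case `p₁ ≡ ±1` is Corollary 3.4 of the tree; (8.1) `(p₁ ± 1, l) = 1` is §1; otherwise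
`l ∣ p₁ + 1` or `l ∣ p₁ − 1` and, replacing `pᵢ` by `±pᵢ` (same multiplicities) with Lemma 4.4 (`l ∣ p₂ + 1` or
`l ∣ p₂ − 1`), we are in case (8.3) of §2. [cite: IkedaYamamoto1979, Main Theorem (`q = 2l^ν`), §8, Lemma 4.4,
Corollary 3.4, Proposition 4.1] -/
theorem dvd_of_lensMultiplicity_one_eq_of_twice_prime_pow {q l ν : ℕ} (hq : q = 2 * l ^ ν) (hl : l.Prime) (hl2 : l ≠ 2)
    (hν : ν ≠ 0) {p₁ p₂ : ℤ} (hp₁ : IsCoprime p₁ q) (hp₂ : IsCoprime p₂ q)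
    (h : ∀ n : ℕ, lensMultiplicity q 1 p₁ n = lensMultiplicity q 1 p₂ n) :
    (q : ℤ) ∣ p₁ - p₂ ∨ (q : ℤ) ∣ p₁ + p₂ ∨ (q : ℤ) ∣ p₁ * p₂ - 1 ∨ (q : ℤ) ∣ p₁ * p₂ + 1 := by
  have hl3 : 3 ≤ l := by have := hl.two_le; omega
  set m : ℕ := l ^ ν with hm
  have hm0 : m ≠ 0 := pow_ne_zero _ hl.ne_zero
  haveI : NeZero m := ⟨hm0⟩
  have hmo : Odd m := (hl.odd_of_ne_two hl2).pow
  have hm3 : 3 ≤ m := hl3.trans (Nat.le_self_pow hν l)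
  subst hq
  haveI : NeZero (2 * m) := ⟨by omega⟩
  -- `ν = 1`: `q = 2l`, row g45-#4
  by_cases hν1 : ν = 1
  · have hml : m = l := by rw [hm, hν1, pow_one]
    haveI : Fact l.Prime := ⟨hl⟩
    rw [hml] at hp₁ hp₂ h ⊢
    exact dvd_of_lensMultiplicity_one_eq_of_twice_prime hl2 hp₁ hp₂ h
  -- `ν ≥ 2`: `l² ∣ m`
  have hll : l * l ∣ m := by
    rw [hm, ← sq]
    exact pow_dvd_pow l (by omega)
  have hlq : (l : ℤ) ∣ ((2 * m : ℕ) : ℤ) := by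
    have : (l : ℤ) ∣ (m : ℤ) := by exact_mod_cast (dvd_mul_right l l).trans hll
    exact this.trans (by push_cast; exact dvd_mul_left _ _)
  have hlP : Prime (l : ℤ) := Nat.prime_iff_prime_int.mp hl
  have honly : ∀ {t : ℤ}, ¬ (l : ℤ) ∣ t → IsCoprime t m := by
    intro t ht
    have h1 : IsCoprime t (l : ℤ) := ((Prime.coprime_iff_not_dvd hlP).mpr ht).symm
    have := h1.pow_right (n := ν)
    rw [hm]; push_cast; exact this
  have hl2' : ¬ (l : ℤ) ∣ 2 := by
    intro hd
    have : l ∣ 2 := by exact_mod_cast hd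
    exact hl2 ((Nat.le_of_dvd two_pos this).antisymm hl.two_le)
  have h1cop : IsCoprime (1 : ℤ) ((2 * m : ℕ) : ℤ) := isCoprime_one_left
  -- the homogeneous case: COROLLARY 3.4
  have hom : ∀ {a b : ℤ}, IsCoprime b ((2 * m : ℕ) : ℤ) →
      (∀ n : ℕ, lensMultiplicity (2 * m) 1 a n = lensMultiplicity (2 * m) 1 b n) →
      (((2 * m : ℕ) : ℤ) ∣ a - 1 ∨ ((2 * m : ℕ) : ℤ) ∣ a + 1) →
      ((2 * m : ℕ) : ℤ) ∣ a - b ∨ ((2 * m : ℕ) : ℤ) ∣ a + b := by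
    intro a b hb hab hhom
    have hhom' : ((2 * m : ℕ) : ℤ) ∣ 1 - a ∨ ((2 * m : ℕ) : ℤ) ∣ 1 + a := by
      rcases hhom with hh | hh
      · exact Or.inl (by rw [← dvd_neg, neg_sub]; exact hh)
      · exact Or.inr (by rwa [add_comm])
    rcases dvd_sub_or_dvd_add_of_lensMultiplicity_eq (2 * m) h1cop h1cop hb hhom' hab with hb' | hb'
    · rcases hhom with hh | hh
      · left; have := dvd_add hh hb'; rwa [show a - 1 + (1 - b) = a - b by ring] at this
      · right; have := dvd_sub hh hb'; rwa [show a + 1 - (1 - b) = a + b by ring] at this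
    · rcases hhom with hh | hh
      · right; have := dvd_add hh hb'; rwa [show a - 1 + (1 + b) = a + b by ring] at this
      · left; have := dvd_sub hh hb'; rwa [show a + 1 - (1 + b) = a - b by ring] at this
  -- case (8.3) for a pair `(a, b)` with `l ∣ a + 1`: `a ≡ ±b` or `ab ≡ ±1`
  have second : ∀ {a b : ℤ}, IsCoprime a ((2 * m : ℕ) : ℤ) → IsCoprime b ((2 * m : ℕ) : ℤ) → (l : ℤ) ∣ a + 1 →
      (∀ n : ℕ, lensMultiplicity (2 * m) 1 a n = lensMultiplicity (2 * m) 1 b n) →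
      ((2 * m : ℕ) : ℤ) ∣ a - b ∨ ((2 * m : ℕ) : ℤ) ∣ a + b ∨
        ((2 * m : ℕ) : ℤ) ∣ a * b - 1 ∨ ((2 * m : ℕ) : ℤ) ∣ a * b + 1 := by
    intro a b ha hb hla hab
    by_cases hqa : ((2 * m : ℕ) : ℤ) ∣ a + 1
    · rcases hom hb hab (Or.inr hqa) with h' | h'
      · exact Or.inl h'
      · exact Or.inr (Or.inl h')
    have hma : IsCoprime (a - 1) m := honly (not_dvd_sub_one_of_dvd_add_one_tp hl hl2 hla)
    obtain ⟨ua, ba, huba⟩ := ha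
    obtain ⟨ub, bb, hubb⟩ := hb
    have hua : ((2 * m : ℕ) : ℤ) ∣ ua * a - 1 := ⟨-ba, by linear_combination huba⟩
    have hub : ((2 * m : ℕ) : ℤ) ∣ ub * b - 1 := ⟨-bb, by linear_combination hubb⟩
    have ha' : IsCoprime a ((2 * m : ℕ) : ℤ) := ⟨ua, ba, huba⟩
    have hb' : IsCoprime b ((2 * m : ℕ) : ℤ) := ⟨ub, bb, hubb⟩
    have h44 := dvd_or_dvd_of_dvd_of_lensMultiplicity_eq hua hub hab hlq hl2' (Or.inl hla)
    have core : ∀ {c : ℤ}, IsCoprime c ((2 * m : ℕ) : ℤ) → (l : ℤ) ∣ c + 1 →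
        (∀ n : ℕ, lensMultiplicity (2 * m) 1 a n = lensMultiplicity (2 * m) 1 c n) →
        ((2 * m : ℕ) : ℤ) ∣ a - c ∨ ((2 * m : ℕ) : ℤ) ∣ a * c - 1 := fun hc hlc hac ↦
      dvd_of_lensMultiplicity_one_eq_of_twice_dvd_add_one hmo hl hl2 hll ha' hc hma
        (honly (not_dvd_sub_one_of_dvd_add_one_tp hl hl2 hlc)) hla hlc hqa hac
    rcases h44 with hlb | hlb
    · rcases core hb' hlb hab with h' | h'
      · exact Or.inl h'
      · exact Or.inr (Or.inr (Or.inl h'))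
    · have hlb' : (l : ℤ) ∣ -b + 1 := by rw [show -b + 1 = -(b - 1) by ring, dvd_neg]; exact hlb
      have hab' : ∀ n : ℕ, lensMultiplicity (2 * m) 1 a n = lensMultiplicity (2 * m) 1 (-b) n := fun n ↦ by
        rw [lensMultiplicity_neg_right, hab n]
      rcases core hb'.neg_left hlb' hab' with h' | h'
      · exact Or.inr (Or.inl (by rw [show a + b = a - -b by ring]; exact h'))
      · exact Or.inr (Or.inr (Or.inr (by rw [show a * b + 1 = -(a * -b - 1) by ring, dvd_neg]; exact h')))
  -- dispatch on `p₁ mod l`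
  by_cases hA : (l : ℤ) ∣ p₁ + 1
  · exact second hp₁ hp₂ hA h
  by_cases hB : (l : ℤ) ∣ p₁ - 1
  · have hB' : (l : ℤ) ∣ -p₁ + 1 := by rw [show -p₁ + 1 = -(p₁ - 1) by ring, dvd_neg]; exact hB
    have h' : ∀ n : ℕ, lensMultiplicity (2 * m) 1 (-p₁) n = lensMultiplicity (2 * m) 1 p₂ n := fun n ↦ by
      rw [lensMultiplicity_neg_right, h n]
    rcases second hp₁.neg_left hp₂ hB' h' with h' | h' | h' | h'
    · exact Or.inr (Or.inl (by rw [show p₁ + p₂ = -(-p₁ - p₂) by ring, dvd_neg]; exact h'))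
    · exact Or.inl (by rw [show p₁ - p₂ = -(-p₁ + p₂) by ring, dvd_neg]; exact h')
    · exact Or.inr (Or.inr (Or.inr (by rw [show p₁ * p₂ + 1 = -(-p₁ * p₂ - 1) by ring, dvd_neg]; exact h')))
    · exact Or.inr (Or.inr (Or.inl (by rw [show p₁ * p₂ - 1 = -(-p₁ * p₂ + 1) by ring, dvd_neg]; exact h')))
  -- (8.1): `(p₁ ± 1, l) = 1`
  exact dvd_of_lensMultiplicity_one_eq_of_twice_odd hmo hm3 hp₁ hp₂ (honly hA) (honly hB) h

/-- **THE MAIN THEOREM (Ikeda–Yamamoto 1979) for `q = 2l^ν`, general weights.** Let `q = 2l^ν` (`l` an odd prime,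
`ν ≥ 1`) and `p₁, p₂, p₁', p₂'` prime to `q`. If `L(q; p₁, p₂)` and `L(q; p₁', p₂')` are isospectral then
`p₁p₂' ≡ ±p₁'p₂` or `p₁p₁' ≡ ±p₂p₂' (mod q)`: the two lens spaces are isometric (Proposition 1.1; reduction to the
normalized form via `L(q; p₁, p₂) ≅ L(q; 1, p₁*p₂)`). [cite: IkedaYamamoto1979, Main Theorem (`q = 2l^ν`), §4, Proposition
1.1] -/
theorem dvd_of_lensMultiplicity_eq_of_twice_prime_pow {q l ν : ℕ} (hq : q = 2 * l ^ ν) (hl : l.Prime) (hl2 : l ≠ 2)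
    (hν : ν ≠ 0) {p₁ p₂ p₁' p₂' : ℤ} (hp₁ : IsCoprime p₁ q) (hp₂ : IsCoprime p₂ q) (hp₁' : IsCoprime p₁' q)
    (hp₂' : IsCoprime p₂' q) (h : ∀ n : ℕ, lensMultiplicity q p₁ p₂ n = lensMultiplicity q p₁' p₂' n) :
    (q : ℤ) ∣ p₁ * p₂' - p₁' * p₂ ∨ (q : ℤ) ∣ p₁ * p₂' + p₁' * p₂ ∨
      (q : ℤ) ∣ p₁ * p₁' - p₂ * p₂' ∨ (q : ℤ) ∣ p₁ * p₁' + p₂ * p₂' := by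
  obtain ⟨u₁, b₁, hub₁⟩ := hp₁
  obtain ⟨u₁', b₁', hub₁'⟩ := hp₁'
  have hu₁ : (q : ℤ) ∣ u₁ * p₁ - 1 := ⟨-b₁, by linear_combination hub₁⟩
  have hu₁' : (q : ℤ) ∣ u₁' * p₁' - 1 := ⟨-b₁', by linear_combination hub₁'⟩
  have hcu₁ : IsCoprime u₁ q := ⟨p₁, b₁, by linear_combination hub₁⟩
  have hcu₁' : IsCoprime u₁' q := ⟨p₁', b₁', by linear_combination hub₁'⟩
  have hred : ∀ n : ℕ, lensMultiplicity q 1 (u₁ * p₂) n = lensMultiplicity q 1 (u₁' * p₂') n := fun n ↦ by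
    rw [← lensMultiplicity_eq_one_left q hu₁ p₂ n, h n, lensMultiplicity_eq_one_left q hu₁' p₂' n]
  have key := dvd_of_lensMultiplicity_one_eq_of_twice_prime_pow hq hl hl2 hν (hcu₁.mul_left hp₂) (hcu₁'.mul_left hp₂')
    hred
  have eU := cast_mul_cast_eq_one_tp hu₁
  have eU' := cast_mul_cast_eq_one_tp hu₁'
  have cast0 : ∀ {t : ℤ}, (q : ℤ) ∣ t → (t : ZMod q) = 0 := fun ht ↦ (ZMod.intCast_zmod_eq_zero_iff_dvd _ _).mpr ht
  rcases key with e | e | e | e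
  · have e' := cast0 e
    push_cast at e'
    refine Or.inl ((ZMod.intCast_zmod_eq_zero_iff_dvd _ _).mp ?_)
    push_cast
    linear_combination (-((p₁ : ZMod q) * (p₁' : ZMod q))) * e' + ((p₁' : ZMod q) * (p₂ : ZMod q)) * eU -
      ((p₁ : ZMod q) * (p₂' : ZMod q)) * eU'
  · have e' := cast0 e
    push_cast at e'
    refine Or.inr (Or.inl ((ZMod.intCast_zmod_eq_zero_iff_dvd _ _).mp ?_))
    push_cast
    linear_combination ((p₁ : ZMod q) * (p₁' : ZMod q)) * e' - ((p₁' : ZMod q) * (p₂ : ZMod q)) * eU -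
      ((p₁ : ZMod q) * (p₂' : ZMod q)) * eU'
  · have e' := cast0 e
    push_cast at e'
    refine Or.inr (Or.inr (Or.inl ((ZMod.intCast_zmod_eq_zero_iff_dvd _ _).mp ?_)))
    push_cast
    linear_combination (-((p₁ : ZMod q) * (p₁' : ZMod q))) * e' +
      ((p₂ : ZMod q) * (p₂' : ZMod q) * (u₁' : ZMod q) * (p₁' : ZMod q)) * eU + ((p₂ : ZMod q) * (p₂' : ZMod q)) * eU'
  · have e' := cast0 e
    push_cast at e'
    refine Or.inr (Or.inr (Or.inr ((ZMod.intCast_zmod_eq_zero_iff_dvd _ _).mp ?_)))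
    push_cast
    linear_combination ((p₁ : ZMod q) * (p₁' : ZMod q)) * e' -
      ((p₂ : ZMod q) * (p₂' : ZMod q) * (u₁' : ZMod q) * (p₁' : ZMod q)) * eU - ((p₂ : ZMod q) * (p₂' : ZMod q)) * eU'

/-- **ISOSPECTRAL ⟺ ISOMETRIC for three-dimensional lens spaces with fundamental group of order `q = 2l^ν`** (`l` an odd
prime, `ν ≥ 1`; the Main Theorem of Ikeda–Yamamoto for this family, with its easy converse, in terms of Ikeda's isometry
criterion `LensWeightsEquivalent`). [cite: IkedaYamamoto1979, Main Theorem and the Theorem of the Introduction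
(`q = 2l^ν`), Proposition 1.1, Proposition 4.1] [cite: Ikeda1980, Theorem 2.1] -/
theorem lensMultiplicity_eq_iff_lensWeightsEquivalent_of_twice_prime_pow {q l ν : ℕ} (hq : q = 2 * l ^ ν) (hl : l.Prime)
    (hl2 : l ≠ 2) (hν : ν ≠ 0) {p₁ p₂ p₁' p₂' : ℤ} (hp₁ : IsCoprime p₁ q) (hp₂ : IsCoprime p₂ q)
    (hp₁' : IsCoprime p₁' q) (hp₂' : IsCoprime p₂' q) :
    (∀ n : ℕ, lensMultiplicity q p₁ p₂ n = lensMultiplicity q p₁' p₂' n) ↔ LensWeightsEquivalent q ![p₁, p₂] ![p₁', p₂'] := by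
  have hq0 : q ≠ 0 := by rw [hq]; exact mul_ne_zero two_ne_zero (pow_ne_zero _ hl.ne_zero)
  constructor
  · intro h
    exact (lensWeightsEquivalent_two_iff hp₁').mpr
      (dvd_of_lensMultiplicity_eq_of_twice_prime_pow hq hl hl2 hν hp₁ hp₂ hp₁' hp₂' h)
  · intro hE n
    have hc : ∀ i : Fin 2, IsCoprime (![p₁, p₂] i) q := fun i ↦ by
      fin_cases i
      · simpa using hp₁
      · simpa using hp₂
    have := LensWeightsEquivalent.lensSpaceMultiplicity_eq (q := q) hq0 hE hc n
    rwa [lensSpaceMultiplicity_two, lensSpaceMultiplicity_two] at this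

/-- **ISOSPECTRAL ⟺ ISOMETRIC for `q ∈ {l^ν, 2l^ν}`** (`l` an odd prime, `ν ≥ 1`): the first two of the three families
`q = l^ν, 2l^ν, 2^ν` for which Ikeda–Yamamoto prove their Main Theorem ("two 3-dimensional lens spaces with fundamental group
of order `q` which are isospectral are isometric"). [cite: IkedaYamamoto1979, Main Theorem and Introduction ("This theorem
will be shown here in this paper only for `q = l^ν, 2l^ν` and `2^ν`"), Proposition 1.1] [cite: Ikeda1980, Theorem 2.1] -/
theorem lensMultiplicity_eq_iff_lensWeightsEquivalent_of_prime_pow_or_twice {q l ν : ℕ} (hq : q = l ^ ν ∨ q = 2 * l ^ ν)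
    (hl : l.Prime) (hl2 : l ≠ 2) (hν : ν ≠ 0) {p₁ p₂ p₁' p₂' : ℤ} (hp₁ : IsCoprime p₁ q) (hp₂ : IsCoprime p₂ q)
    (hp₁' : IsCoprime p₁' q) (hp₂' : IsCoprime p₂' q) :
    (∀ n : ℕ, lensMultiplicity q p₁ p₂ n = lensMultiplicity q p₁' p₂' n) ↔ LensWeightsEquivalent q ![p₁, p₂] ![p₁', p₂'] := by
  rcases hq with hq | hq
  · exact lensMultiplicity_eq_iff_lensWeightsEquivalent_of_prime_pow hq hl hl2 hν hp₁ hp₂ hp₁' hp₂'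
  · exact lensMultiplicity_eq_iff_lensWeightsEquivalent_of_twice_prime_pow hq hl hl2 hν hp₁ hp₂ hp₁' hp₂'

/-! ### §4 Small orders: `q ∣ 8`, and LEMMA 6.1 (`q ≤ 10`) -/

/-- The residues of odd numbers mod `8` are `±1, ±3`, with `(±1)(±3) = ±3`, `(±3)(±3) = ±1`: for units `a, b, c, d` of
`ℤ/8` with `a ≠ ±b` and `c ≠ ±d`, `ad = ±cb`. [folklore] -/
private theorem mul_eq_or_eq_neg_of_zmod_eight_tp : ∀ a b c d : ZMod 8, a * a = 1 → b * b = 1 → c * c = 1 → d * d = 1 →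
    a ≠ b → a ≠ -b → c ≠ d → c ≠ -d → (a * d = c * b ∨ a * d = -(c * b)) := by
  decide

/-- An odd number squares to `1` mod `8`. [folklore] -/
private theorem cast_mul_self_eq_one_of_odd_tp {p : ℤ} (hp : Odd p) : (p : ZMod 8) * (p : ZMod 8) = 1 := by
  obtain ⟨r, rfl⟩ := hp
  obtain ⟨s, hs⟩ := Int.even_mul_succ_self r
  have h8 : (8 : ℤ) ∣ (2 * r + 1) * (2 * r + 1) - 1 := ⟨s, by linear_combination 4 * hs⟩
  have h0 := (ZMod.intCast_zmod_eq_zero_iff_dvd _ 8).mpr h8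
  push_cast at h0 ⊢
  linear_combination h0

/-- **The Main Theorem for `q ∣ 8`** (the dyadic part of LEMMA 6.1, "Main Theorem holds when `q ≤ 10`"): for `q ∈ {1, 2, 4, 8}`
and weights prime to `q`, isospectral `L(q; p₁, p₂)`, `L(q; p₁', p₂')` are isometric. For such `q` every weight pair is
either homogeneous (`p₁ ≡ ±p₂`) or, only when `q = 8`, congruent to `(±1, ±3)` up to order, and all the latter are
equivalent; a homogeneous space is isospectral only to homogeneous ones (Corollary 3.4, the tree's
`dvd_sub_or_dvd_add_of_lensMultiplicity_eq`). [cite: IkedaYamamoto1979, Lemma 6.1, Corollary 3.4, Proposition 1.2,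
Proposition 1.1] -/
theorem dvd_of_lensMultiplicity_eq_of_dvd_eight {q : ℕ} (hq : q ∣ 8) {p₁ p₂ p₁' p₂' : ℤ} (hp₁ : IsCoprime p₁ q)
    (hp₂ : IsCoprime p₂ q) (hp₁' : IsCoprime p₁' q) (hp₂' : IsCoprime p₂' q)
    (h : ∀ n : ℕ, lensMultiplicity q p₁ p₂ n = lensMultiplicity q p₁' p₂' n) :
    (q : ℤ) ∣ p₁ * p₂' - p₁' * p₂ ∨ (q : ℤ) ∣ p₁ * p₂' + p₁' * p₂ ∨
      (q : ℤ) ∣ p₁ * p₁' - p₂ * p₂' ∨ (q : ℤ) ∣ p₁ * p₁' + p₂ * p₂' := by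
  -- two homogeneous pairs are equivalent
  have homhom : ∀ {a b c d : ℤ}, ((q : ℤ) ∣ a - b ∨ (q : ℤ) ∣ a + b) → ((q : ℤ) ∣ c - d ∨ (q : ℤ) ∣ c + d) →
      (q : ℤ) ∣ a * d - c * b ∨ (q : ℤ) ∣ a * d + c * b := by
    intro a b c d hab hcd
    rcases hab with ⟨x, hx⟩ | ⟨x, hx⟩ <;> rcases hcd with ⟨y, hy⟩ | ⟨y, hy⟩
    · exact Or.inl ⟨x * d - y * b, by linear_combination d * hx - b * hy⟩
    · exact Or.inr ⟨x * d + y * b, by linear_combination d * hx + b * hy⟩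
    · exact Or.inr ⟨x * d + y * b, by linear_combination d * hx + b * hy⟩
    · exact Or.inl ⟨x * d - y * b, by linear_combination d * hx - b * hy⟩
  by_cases hhom : (q : ℤ) ∣ p₁ - p₂ ∨ (q : ℤ) ∣ p₁ + p₂
  · have hhom' := dvd_sub_or_dvd_add_of_lensMultiplicity_eq q hp₁ hp₁' hp₂' hhom h
    rcases homhom hhom hhom' with h' | h'
    · exact Or.inl h'
    · exact Or.inr (Or.inl h')
  by_cases hhom' : (q : ℤ) ∣ p₁' - p₂' ∨ (q : ℤ) ∣ p₁' + p₂'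
  · have hhom₁ := dvd_sub_or_dvd_add_of_lensMultiplicity_eq q hp₁' hp₁ hp₂ hhom' (fun n ↦ (h n).symm)
    exact absurd hhom₁ hhom
  -- both pairs non-homogeneous: only possible for `q = 8`, and then `p₁p₂' ≡ ±p₁'p₂ (mod 8)`
  rw [not_or] at hhom hhom'
  have hq1 : q ≠ 1 := by
    rintro rfl
    exact hhom.1 (by push_cast; exact one_dvd _)
  have hq2 : (2 : ℤ) ∣ (q : ℤ) := by
    have hq8 : q ≤ 8 := Nat.le_of_dvd (by norm_num) hq
    interval_cases q <;> omega
  have hodd : ∀ {p : ℤ}, IsCoprime p q → Odd p := by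
    intro p hp
    rw [← Int.not_even_iff_odd]
    rintro ⟨c, rfl⟩
    obtain ⟨e, he⟩ := hq2
    obtain ⟨a, b, hab⟩ := hp
    have : (2 : ℤ) ∣ 1 := ⟨a * c + b * e, by rw [← hab, he]; ring⟩
    omega
  have h8q : (q : ℤ) ∣ 8 := by exact_mod_cast hq
  have ne_of : ∀ {x : ℤ}, ¬ (q : ℤ) ∣ x → (x : ZMod 8) ≠ 0 := fun hx h0 ↦
    hx (h8q.trans ((ZMod.intCast_zmod_eq_zero_iff_dvd _ 8).mp h0))
  have key := mul_eq_or_eq_neg_of_zmod_eight_tp (p₁ : ZMod 8) (p₂ : ZMod 8) (p₁' : ZMod 8) (p₂' : ZMod 8)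
    (cast_mul_self_eq_one_of_odd_tp (hodd hp₁)) (cast_mul_self_eq_one_of_odd_tp (hodd hp₂))
    (cast_mul_self_eq_one_of_odd_tp (hodd hp₁')) (cast_mul_self_eq_one_of_odd_tp (hodd hp₂'))
    (fun e ↦ ne_of hhom.1 (by push_cast; rw [e]; ring)) (fun e ↦ ne_of hhom.2 (by push_cast; rw [e]; ring))
    (fun e ↦ ne_of hhom'.1 (by push_cast; rw [e]; ring)) (fun e ↦ ne_of hhom'.2 (by push_cast; rw [e]; ring))
  rcases key with e | e
  · refine Or.inl (h8q.trans ((ZMod.intCast_zmod_eq_zero_iff_dvd _ 8).mp ?_))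
    push_cast; rw [e]; ring
  · refine Or.inr (Or.inl (h8q.trans ((ZMod.intCast_zmod_eq_zero_iff_dvd _ 8).mp ?_)))
    push_cast; rw [e]; ring

/-- **ISOSPECTRAL ⟺ ISOMETRIC for `q ∣ 8`** (`q = 2^ν`, `ν ≤ 3`). [cite: IkedaYamamoto1979, Lemma 6.1, Proposition 1.1]
[cite: Ikeda1980, Theorem 2.1] -/
theorem lensMultiplicity_eq_iff_lensWeightsEquivalent_of_dvd_eight {q : ℕ} (hq : q ∣ 8) {p₁ p₂ p₁' p₂' : ℤ}
    (hp₁ : IsCoprime p₁ q) (hp₂ : IsCoprime p₂ q) (hp₁' : IsCoprime p₁' q) (hp₂' : IsCoprime p₂' q) :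
    (∀ n : ℕ, lensMultiplicity q p₁ p₂ n = lensMultiplicity q p₁' p₂' n) ↔ LensWeightsEquivalent q ![p₁, p₂] ![p₁', p₂'] := by
  have hq0 : q ≠ 0 := by rintro rfl; norm_num at hq
  constructor
  · intro h
    exact (lensWeightsEquivalent_two_iff hp₁').mpr (dvd_of_lensMultiplicity_eq_of_dvd_eight hq hp₁ hp₂ hp₁' hp₂' h)
  · intro hE n
    have hc : ∀ i : Fin 2, IsCoprime (![p₁, p₂] i) q := fun i ↦ by
      fin_cases i
      · simpa using hp₁
      · simpa using hp₂
    have := LensWeightsEquivalent.lensSpaceMultiplicity_eq (q := q) hq0 hE hc n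
    rwa [lensSpaceMultiplicity_two, lensSpaceMultiplicity_two] at this

/-- **LEMMA 6.1 (Ikeda–Yamamoto 1979): "Main Theorem holds when `q ≤ 10`"** — for `1 ≤ q ≤ 10` and weights prime to `q`,
isospectral three-dimensional lens spaces `L(q; p₁, p₂)`, `L(q; p₁', p₂')` are isometric (and conversely): `q ∈ {1, 2, 4, 8}`
by `lensMultiplicity_eq_iff_lensWeightsEquivalent_of_dvd_eight`, `q ∈ {3, 5, 7, 9}` as odd prime powers (row g45-#6),
`q ∈ {6, 10}` as `2l` (row g45-#4). [cite: IkedaYamamoto1979, Lemma 6.1, Main Theorem] [cite: Ikeda1980, Theorem 2.1] -/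
theorem lensMultiplicity_eq_iff_lensWeightsEquivalent_of_le_ten {q : ℕ} (hq0 : q ≠ 0) (hq : q ≤ 10) {p₁ p₂ p₁' p₂' : ℤ}
    (hp₁ : IsCoprime p₁ q) (hp₂ : IsCoprime p₂ q) (hp₁' : IsCoprime p₁' q) (hp₂' : IsCoprime p₂' q) :
    (∀ n : ℕ, lensMultiplicity q p₁ p₂ n = lensMultiplicity q p₁' p₂' n) ↔ LensWeightsEquivalent q ![p₁, p₂] ![p₁', p₂'] := by
  have h3 : Nat.Prime 3 := by norm_num
  have h5 : Nat.Prime 5 := by norm_num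
  have h7 : Nat.Prime 7 := by norm_num
  interval_cases q
  · exact absurd rfl hq0
  · exact lensMultiplicity_eq_iff_lensWeightsEquivalent_of_dvd_eight (by norm_num) hp₁ hp₂ hp₁' hp₂'
  · exact lensMultiplicity_eq_iff_lensWeightsEquivalent_of_dvd_eight (by norm_num) hp₁ hp₂ hp₁' hp₂'
  · exact lensMultiplicity_eq_iff_lensWeightsEquivalent_of_prime_pow (l := 3) (ν := 1) (by norm_num) h3 (by norm_num)
      one_ne_zero hp₁ hp₂ hp₁' hp₂'
  · exact lensMultiplicity_eq_iff_lensWeightsEquivalent_of_dvd_eight (by norm_num) hp₁ hp₂ hp₁' hp₂'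
  · exact lensMultiplicity_eq_iff_lensWeightsEquivalent_of_prime_pow (l := 5) (ν := 1) (by norm_num) h5 (by norm_num)
      one_ne_zero hp₁ hp₂ hp₁' hp₂'
  · exact lensMultiplicity_eq_iff_lensWeightsEquivalent_of_twice_prime_pow (l := 3) (ν := 1) (by norm_num) h3 (by norm_num)
      one_ne_zero hp₁ hp₂ hp₁' hp₂'
  · exact lensMultiplicity_eq_iff_lensWeightsEquivalent_of_prime_pow (l := 7) (ν := 1) (by norm_num) h7 (by norm_num)
      one_ne_zero hp₁ hp₂ hp₁' hp₂'
  · exact lensMultiplicity_eq_iff_lensWeightsEquivalent_of_dvd_eight (by norm_num) hp₁ hp₂ hp₁' hp₂'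
  · exact lensMultiplicity_eq_iff_lensWeightsEquivalent_of_prime_pow (l := 3) (ν := 2) (by norm_num) h3 (by norm_num)
      two_ne_zero hp₁ hp₂ hp₁' hp₂'
  · exact lensMultiplicity_eq_iff_lensWeightsEquivalent_of_twice_prime_pow (l := 5) (ν := 1) (by norm_num) h5 (by norm_num)
      one_ne_zero hp₁ hp₂ hp₁' hp₂'

end Literature.Analysis.InnerProduct
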